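import Summits.BirchSwinnertonDyer.BirchSwinnertonDyer.Theses.PrintCf2
import Summits.BirchSwinnertonDyer.BirchSwinnertonDyer.Theorems.PrintCf2RamifiedOffTYZEvenOmegaIdentity
import HarnessLib

/-!
# Route `PrintCf2`, aside stmt-BirchSwinnertonDyer-26114 `RamifiedLowerHalfEvenAllOfFacts` — CLOSER BY NAME

The aside filed by planner g22 (route A rev 53) under crux stmt-BirchSwinnertonDyer-20509 / item 23431 (C⁺): the LOWER HALF of C⁺ on the whole EVEN
jump-one class `n = 2p₁⋯p_k ≡ 6 (mod 8)` (`#Sel₂(E_n) = 2^{2+s}`, `s ≥ 2`, `ord_{s=1} L(E_n,s) = 1`, generator with `x(R) ∉ ⟨−1, 2, n⟩·ℚ^{×2}`), for every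
`k`, from the named facts `tyz_cmPointRingClassFrobeniusValueData ∧ thm11_parity_of_scriptL ∧ GZK`.  Proved BY NAME by the cycle-15 theorem of the crux
LEAD lineage (cruxlead-20509 g14, p754196 `MoverAssembly.two_dvd_scriptL_even_allk_of_facts`, through g13's `…EvenOmegaSilence` and the kernel proof of
the even Ω-identity).  Closer certified by the planner (`HOME/bsd-print-cf2-plan/routeA53/AsideEvenAll_v2.lean`) and landed by cruxlead-20509 g16.
CONDITIONAL on three named facts without `_holds`; BSD is not proved by any of this; crux 20509 / item 23431 are NOT closed by this file.

References: [cite: TianYuanZhang2017, Thm. 1.1, §1 (p0002 L101–L110), §3 (Prop. 3.2 (2), Thm. 3.5, Thm. 3.6 (2), Lemma 3.18, proof of Lemma 3.21)];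
[cite: Cox2013, §5.C Thm. 5.23, Cor. 5.25, §9.A]; [cite: HeathBrown1994SelmerCongruentII, §1, Appendix (Monsky)]; [cite: Darmon2004, Thm. 3.22].
-/

set_option linter.dupNamespace false

namespace Summit.BirchSwinnertonDyer.BirchSwinnertonDyer.Theorems

/-- **Aside `RamifiedLowerHalfEvenAllOfFacts` (stmt-BirchSwinnertonDyer-26114), by name**: granted
`tyz_cmPointRingClassFrobeniusValueData ∧ thm11_parity_of_scriptL ∧ rank_eq_analyticRank_of_analyticRank_le_one`, for every square-free
`n = 2p₁⋯p_k` with `∏pᵢ ≡ 3 (mod 4)`, `#Sel₂(E_n) = 2^{2+s}` (`s ≥ 2`), `ord_{s=1} L(E_n, s) = 1` and a generator `(x, y)` of `E_n(ℚ)` modulo torsion with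
`x ∉ {±1, ±n}·ℚ^{×2}` and `x ∉ {±2, ±2n}·ℚ^{×2}`, every `L` with `𝓛(n)² = L²` is even.
[cite: TianYuanZhang2017, Thm. 1.1 and §3 (Prop. 3.2 (2), Thm. 3.5, Thm. 3.6 (2), Lemma 3.18, proof of Lemma 3.21)] [cite: Cox2013, §5.C Cor. 5.25, §9.A] [cite: Darmon2004, Thm. 3.22] -/
theorem ramifiedLowerHalfEvenAllOfFacts_proof :
    Summit.BirchSwinnertonDyer.BirchSwinnertonDyer.Theses.PrintCf2.RamifiedLowerHalfEvenAllOfFacts :=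
  fun hF _ p hp hodd hinj _ hn h3 hsq _ hs hsel hra _ _ hxy hgen hx hx2 =>
    Summit.BirchSwinnertonDyer.PrintCf2.MoverAssembly.two_dvd_scriptL_even_allk_of_facts p hp hodd hinj hF hn h3 hsq hs hsel hra hxy hgen hx hx2

end Summit.BirchSwinnertonDyer.BirchSwinnertonDyer.Theorems
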